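import Summits.ResolutionOfSingularities.ResolutionOfSingularities.Theorems.StallVertexEcho
import HarnessLib

/-!
# StallVertexDeficiency — decomp-res node «StallVertex» (lens-5 g22 rev 7/8), add-on tree file 18 of the node

Content VERBATIM from the decomp-res lens-5 file `HOME/decomp-res-lens-5/g22/StallVertex.lean` rev 8 (pin 9799ca34,
4 539 l; rev 8 = rev 7 25c16fe6 +
five pure insertions §1j/§1k/§2d/§3i/§4i/§4j; rev 7 = pure insertions §2c/§4h over the landed rev-6 content
95ed6f6f — all earlier statements
byte-identical (critic machine diffs, CRITIC-LEDGER rows 142g / 142h); HOME = run/shared/lean/pub/decomp-res).  The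
rev-0…6 sections are ALREADY in the
tree (`StallVertexForms` / `Kernels` / `Walk` / `Classes` / `Clean` / `Rigid` / `Lines` / `RigidClasses` / `Carry` /
`OldLetter` / `LineTurn` /
`LetterClasses` / `Regime` / `StraightClasses` + wiring `MaxContactCutStallVertex` /
`MaxContactCutStallVertexEvents`, writer g7/g8); the rev-7/8 add-on
files carry ONLY the 53 declarations NEW in rev 7 / rev 8.  Critic: CRITIC-LEDGER row 142g (rev 7, DECIDED +1 (Y):
THE DEFICIENCY LAW — the positive
young-monomial regime is EMPTY, positive differential shade is an interference phenomenon, exact re-location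
`monomialRegime_iff_flat`; inhabitants
T-regime 3 353/116; 2026-08-30T23:43:05Z) and row 142h (rev 8, BOOKED 0: RESONANCE / ECHO / NULL / COINCIDENCE laws
+ the exact two-leaf split
`defectWalksDeep_iff_positive_nullFlat`; 2026-08-31T00:03:14Z) — landing orders INBOX :525 / :543.  Landed by
decomp-res writer g9 as
`StallVertexEcho` (§1j + §1k + §3i), `StallVertexDeficiency` (§2c + §2d), `StallVertexDeficiencyLaw` (§4h
kernels: `FlatMonomialAt` … `muTilde_eq_zero_of_regime`),
`StallVertexFlatClasses` (§4h cells and exact re-locations), `StallVertexNullClasses` (§4i + §4j cells and exact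
re-locations) and the wiring file
`MaxContactCutStallVertexFlat` (every new `closes_…` / `defectWalksDeep_iff_…` BY NAME on
`MaxContactCut.DefectWalksDeep`).  All
`--supports stmt-ResolutionOfSingularities-31770`.  Every file of the node is in the Theses cone (the lens imports
the in-cone `DifferentialShade`), so the
located residual is booked on the route by RE-LOCATING the existing aside 28122 `CFNoSkewJointTailsDeep` (informal-only edit) to
`StallVertex.NoFlatRegimeSkewStalledTailsDeep` ≡ `NoPositiveSkewStalledTailsDeep ∧
NoNullFlatSkewStalledTailsDeep` (EXACT, hypothesis-free chain
skew ↔ … ↔ monomialRegime ↔ flat ↔ positive ∧ nullFlat: `skew_iff_flat`, `skew_iff_positive_nullFlat`)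
— one aside on this column (critic rows 142g/142h:
«file only the newest, exactly one aside on the column; decided cells and the μ̃-sign leaves NOT filed»).

§2c (rev 7, `section Vertex`) DEFICIENCY — the young divisor masses against a monomial of the minimiser:
`mem_support_of_cone`, `muPD_le_exponent`,
`untopD_muPD_le_exponent`, `divisorOrder_eq_of_nondeficient`, the one-move deficiency laws **`lost_nondeficient`** /
**`new_nondeficient`** /
**`kept_nondeficient`**; §2d (rev 8) THE NULL LAW — `μ̃ = 0` forces the FLAT young monomial cone:
`young_exponent_of_muTilde_zero`,
**`flat_cone_of_muTilde_zero`**.  PROVED, 0 sorry.  Imports `StallVertexEcho`.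

[WRITER NOTE (decomp-res writer g9): file split only; namespace, opens, section variables and every declaration
exactly as in the lens (global `set_option` dropped; the lens's `set_option maxHeartbeats … in` lines kept; the
lens's private copy `flat_monomial'` of the landed
`Literature.AlgebraicGeometry.Resolution.PointBlowup.flat_monomial` is cited by its full name, as in `StallVertexCarry`).]

(Sources: KawanoueMatsuki2016 Prop. 4 (2), §4.1; Kawanoue2007 Lemma 2.2.1.2; BierstoneGrigorievMilmanWlodarczyk2011
Def. 3.1.3; Hauser2010; HauserPerlega2024; Moh1987; CossartPiltant2008; Giraud1975; Hironaka1964; ZariskiSamuelII Ch. VIII §2.)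
-/

noncomputable section

open MvPolynomial Finset
open Literature.AlgebraicGeometry.Resolution
open Literature.AlgebraicGeometry.Resolution.Hauser2010
open Literature.AlgebraicGeometry.Resolution.HauserPerlega2024
open Literature.Barriers.ResolutionOfSingularities
open Literature.AlgebraicGeometry.Resolution.PointBlowup
open Summit.ResolutionOfSingularities.ResolutionOfSingularities.Theses
open Summit.ResolutionOfSingularities.ResolutionOfSingularities.Theorems.TightDefectClasses
open Summit.ResolutionOfSingularities.ResolutionOfSingularities.Theorems.ProximityCut
open Summit.ResolutionOfSingularities.ResolutionOfSingularities.Theorems.ExitLaw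
open Summit.ResolutionOfSingularities.ResolutionOfSingularities.Theorems.DifferentialShade

namespace Summit.ResolutionOfSingularities.ResolutionOfSingularities.Theorems.StallVertex

section Vertex

variable {σ : Type*} {K : Type*} [Field K] [Fintype σ] [DecidableEq σ] [DecidableEq K]

/-! ### §2c (rev 7, generation 22) DEFICIENCY — the young divisor masses against a monomial of the minimiser

For a minimiser `J₀` (level `a₀ = q − |J₀|`) and a monomial `u^S` OF `g₀ = t.gen J₀` (`S ∈ supp g₀`)
every divisor
mass is bounded by the exponent, `a₀ · μ_{P,D_i} ≤ S_i` (`μ_{P,D_i} ≤ ord_{u_i} g₀ / a₀ ≤ S_i / a₀`,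
`muPD_le_exponent`): the DEFICIENCY of the letter `i` against `S` is the slack `δ_i = S_i − a₀ μ_{P,D_i} ≥ 0`.  When
the cone of the minimiser is a YOUNG monomial `ρ·u^S`, `a₀ · μ̃ = Σ_young δ_i`.  THE LOST-LETTER LAW
(`lost_nondeficient`): at a `μ̃`-stall every LOST young letter (`i = j ∨ b_i ≠ 0`) is NON-DEFICIENT,
`a₀ μ_{P,D_i} = S_i` — stall rigidity (1) `mult_direction in(g₀) = d₀ − a₀·lostMass`, computed on the
monomial cone
(`mult = Σ_kept S_i`, `ordZero_dehom_monomial`), against `a₀ μ_{P,D_i} ≤ S_i` termwise.  THE NEW-LETTER LAW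
(`new_nondeficient`) is stall rigidity (5), `μ_{P',D_j} = μ_P − 1 = (d₀ − a₀)/a₀`; THE KEPT-LETTER LAW
(`kept_nondeficient`): a kept letter's mass cannot decrease (`divisorOrder_le_divisorOrder_kept`) and cannot exceed
its exponent in a monomial of the transported minimiser. [new] -/

omit [Fintype σ] [DecidableEq σ] [DecidableEq K] in
/-- A monomial of the initial form is a monomial of the series: `ρ ≠ 0`, `in_{|S|}(G) = ρ·u^S ⟹ S ∈ supp G`.
[folklore] -/
theorem mem_support_of_cone {G : MvPolynomial σ K} {S : σ →₀ ℕ} {ρ : K} (hρ : ρ ≠ 0)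
    (hG : homogeneousComponent S.degree G = monomial S ρ) : S ∈ G.support := by
  classical
  exact mem_support_of_mem_support_homogeneousComponent (d := S.degree)
    (by rw [hG, support_monomial, if_neg hρ]; exact Finset.mem_singleton_self _)

omit [Fintype σ] [DecidableEq σ] [DecidableEq K] in
/-- **(D0) DEFICIENCY IS NON-NEGATIVE**: `μ_{P,D_i} ≤ S_i / a₀` for every monomial `u^S` of the generator `t.gen J₀`
of level `a₀ = q − |J₀|` (`μ_{P,D_i} ≤ ord_{u_i}(t.gen J₀) / a₀ ≤ S_i / a₀`). (Sources:
KawanoueMatsuki2016, §4.1 (definition of μ_{P,D}); new.) -/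
theorem muPD_le_exponent (q : ℕ) (t : IFPState σ K) {J₀ : σ →₀ ℕ} (hJ₀ : J₀ ∈ t.idx) {S : σ →₀ ℕ}
    (hS : S ∈ (t.gen J₀).support) (i : σ) :
    t.muPD q i ≤ ((((S i : ℕ) : ℚ) / (q - J₀.degree : ℕ) : ℚ) : WithTop ℚ) :=
  calc t.muPD q i ≤ levelRatio (divisorOrder i (t.gen J₀)) (q - J₀.degree) := Finset.inf_le hJ₀
    _ ≤ levelRatio ((S i : ℕ) : ℕ∞) (q - J₀.degree) := levelRatio_mono (divisorOrder_le_exponent hS) _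
    _ = _ := levelRatio_natCast _ _

omit [Fintype σ] [DecidableEq σ] [DecidableEq K] in
/-- (D0) on the numbers: `untopD 0 μ_{P,D_i} ≤ S_i / a₀`. [folklore] -/
theorem untopD_muPD_le_exponent (q : ℕ) (t : IFPState σ K) {J₀ : σ →₀ ℕ} (hJ₀ : J₀ ∈ t.idx) {S : σ →₀ ℕ}
    (hS : S ∈ (t.gen J₀).support) (i : σ) :
    (t.muPD q i).untopD 0 ≤ ((S i : ℕ) : ℚ) / (q - J₀.degree : ℕ) :=
  untopD_le_of_le_coe (muPD_le_exponent q t hJ₀ hS i)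

omit [Fintype σ] [DecidableEq σ] [DecidableEq K] in
/-- **THE CONE IS THE BOUNDARY at a non-deficient letter**: if `u^S` is a monomial of the carried derivative `g_{J₀}`
and the young letter `i` is NON-DEFICIENT against it, `μ_{P,D_i} = S_i / a₀`, then the divisor order of `g_{J₀}` along
`D_i` is EXACTLY `S_i` — every monomial of `g_{J₀}` is divisible by `u_i^{S_i}`. [new] [folklore] -/
theorem divisorOrder_eq_of_nondeficient (q : ℕ) (t : IFPState σ K) {J₀ : σ →₀ ℕ} (hJ₀ : J₀ ∈ t.idx)
    (hlev : J₀.degree < q) {S : σ →₀ ℕ} (hS : S ∈ (t.gen J₀).support) {i : σ}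
    (hx : t.muPD q i = ((((S i : ℕ) : ℚ) / (q - J₀.degree : ℕ) : ℚ) : WithTop ℚ)) :
    divisorOrder i (t.gen J₀) = ((S i : ℕ) : ℕ∞) := by
  have hle : divisorOrder i (t.gen J₀) ≤ ((S i : ℕ) : ℕ∞) := divisorOrder_le_exponent hS
  have hne : divisorOrder i (t.gen J₀) ≠ ⊤ := ne_top_of_le_ne_top (ENat.coe_ne_top (S i)) hle
  obtain ⟨n, hn⟩ := ENat.ne_top_iff_exists.mp hne
  rw [← hn] at hle ⊢
  have hle' : n ≤ S i := by exact_mod_cast hle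
  have hμle : t.muPD q i ≤ levelRatio (divisorOrder i (t.gen J₀)) (q - J₀.degree) := Finset.inf_le hJ₀
  rw [hx, ← hn, levelRatio_natCast, WithTop.coe_le_coe] at hμle
  have ha₀ : (0 : ℚ) < ((q - J₀.degree : ℕ) : ℚ) := by exact_mod_cast Nat.sub_pos_of_lt hlev
  have hSn : ((S i : ℕ) : ℚ) ≤ (n : ℚ) := (div_le_div_iff_of_pos_right ha₀).mp hμle
  have hSn' : S i ≤ n := by exact_mod_cast hSn
  exact_mod_cast le_antisymm hle' hSn'

/-- **(D1) THE LOST-LETTER LAW.**  At a `μ̃`-stalled move `(j, b)` of a corner state at a point of `Sing`, let the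
minimiser `J₀` (level `a₀`) have the YOUNG MONOMIAL cone `ρ·u^S` (`|S| = ord₀ g₀`, every letter of `S` young).  Then
every LOST young letter — the chart letter `j` and every translated letter `b_i ≠ 0` — is NON-DEFICIENT:
`μ_{P,D_i} = S_i / a₀`.  (Stall rigidity (1) gives `mult_direction in(g₀) = |S| − a₀·lostMass`; on the monomial cone
`mult_direction = Σ_{kept} S_i`; so `Σ_{lost} (S_i − a₀ μ_{P,D_i}) = 0` with non-negative terms.) [new] [folklore] -/
theorem lost_nondeficient (q : ℕ) (j : σ) (b : σ → K) (hbj : b j = 0) (t : IFPState σ K)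
    (hlev : ∀ J ∈ t.idx, J.degree < q)
    (hsing : ∀ J ∈ t.idx, t.gen J ≠ 0 → (((q - J.degree : ℕ) : ℕ∞)) ≤ ordZero (t.gen J))
    (hstall : t.muTilde q ≤ (t.step q j b).muTilde q)
    {J₀ : σ →₀ ℕ} (hJ₀ : J₀ ∈ t.idx) (hμ : t.muP q = levelRatio (ordZero (t.gen J₀)) (q - J₀.degree))
    {S : σ →₀ ℕ} {ρ : K} (hρ : ρ ≠ 0) (hd₀ : ordZero (t.gen J₀) = ((S.degree : ℕ) : ℕ∞))
    (hG : homogeneousComponent S.degree (t.gen J₀) = monomial S ρ) (hyoung : ∀ i, S i ≠ 0 → i ∈ t.young)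
    {i : σ} (hi : i ∈ t.young) (hlost : i = j ∨ b i ≠ 0) :
    t.muPD q i = ((((S i : ℕ) : ℚ) / (q - J₀.degree : ℕ) : ℚ) : WithTop ℚ) := by
  classical
  have h1 := (stall_rigid q j b hbj t hlev hsing hstall hJ₀ hμ hd₀).1
  have hn : ordZero (dirForm S.degree j b (t.gen J₀)) =
      ((∑ k ∈ univ.filter (fun k => ¬ (k = j ∨ b k ≠ 0)), S k : ℕ) : ℕ∞) := by
    rw [dirForm_eq_dehom, hG, ordZero_dehom_monomial j b S hρ]
  rw [hn, ENat.toNat_coe] at h1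
  set a₀ : ℕ := q - J₀.degree with ha₀
  have ha₀pos : (0 : ℚ) < (a₀ : ℚ) := by
    have := hlev J₀ hJ₀
    exact_mod_cast (show 0 < a₀ by omega)
  set u : σ → ℚ := fun k => (t.muPD q k).untopD 0 with hu
  have hS : S ∈ (t.gen J₀).support := mem_support_of_cone hρ hG
  -- (D0) termwise: `a₀ u_k ≤ S_k`
  have hdef : ∀ k, (a₀ : ℚ) * u k ≤ ((S k : ℕ) : ℚ) := by
    intro k
    have h := untopD_muPD_le_exponent q t hJ₀ hS k
    rw [mul_comm]
    exact (le_div_iff₀ ha₀pos).mp h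
  -- `|S| = Σ_lost S_k + Σ_kept S_k`
  have hdeg : ((S.degree : ℕ) : ℚ) =
      ((∑ k ∈ univ.filter (fun k => k = j ∨ b k ≠ 0), S k : ℕ) : ℚ) +
        ((∑ k ∈ univ.filter (fun k => ¬ (k = j ∨ b k ≠ 0)), S k : ℕ) : ℚ) := by
    rw [Finsupp.degree_eq_sum, ← Nat.cast_add, Finset.sum_filter_add_sum_filter_not]
  -- the lost exponents over ALL letters = over the YOUNG letters (`S` is young-supported)
  have hly : ∑ k ∈ univ.filter (fun k => k = j ∨ b k ≠ 0), S k =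
      ∑ k ∈ t.young.filter (fun k => k = j ∨ b k ≠ 0), S k := by
    symm
    refine Finset.sum_subset (Finset.filter_subset_filter _ (Finset.subset_univ _)) fun k hk hk' => ?_
    by_contra hSk
    exact hk' (Finset.mem_filter.mpr ⟨hyoung k hSk, (Finset.mem_filter.mp hk).2⟩)
  -- `Σ_{lost young} (S_k − a₀ u_k) = 0`
  have hsum0 : ∑ k ∈ t.young.filter (fun k => k = j ∨ b k ≠ 0), (((S k : ℕ) : ℚ) - (a₀ : ℚ) * u k) = 0 := by
    rw [Finset.sum_sub_distrib, ← Finset.mul_sum]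
    have hlm : (a₀ : ℚ) * lostMass q j b t = (a₀ : ℚ) * ∑ k ∈ t.young.filter (fun k => k = j ∨ b k ≠ 0), u k := by
      rw [lostMass]
    rw [← hlm, ← Nat.cast_sum, ← hly]
    linarith [h1, hdeg]
  have hterm := (Finset.sum_eq_zero_iff_of_nonneg fun k _ => sub_nonneg.mpr (hdef k)).mp hsum0 i
    (Finset.mem_filter.mpr ⟨hi, hlost⟩)
  -- conclude on `WithTop ℚ`
  have hne : t.muPD q i ≠ ⊤ := ne_top_of_le_ne_top WithTop.coe_ne_top (muPD_le_exponent q t hJ₀ hS i)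
  obtain ⟨y, hy⟩ := WithTop.ne_top_iff_exists.mp hne
  have huy : u i = y := by
    show (t.muPD q i).untopD 0 = y
    rw [← hy]; rfl
  rw [← hy, WithTop.coe_eq_coe]
  rw [huy] at hterm
  have hmul : (a₀ : ℚ) * y = ((S i : ℕ) : ℚ) := by linarith [hterm]
  rw [eq_div_iff ha₀pos.ne', mul_comm]
  exact hmul

/-- **(D2, new letter) THE NEW-LETTER LAW** — stall rigidity (5) read as non-deficiency: at a `μ̃`-stalled move the
new exceptional letter `j` carries `μ_{P',D_j} = μ_P − 1 = (d₀ − a₀)/a₀`, the share of the re-booked exponent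
`S'_j = d₀ − a₀` of the transported cone (`monomial_step`). (Sources: KawanoueMatsuki2016, Proposition 4 (2); new.) -/
theorem new_nondeficient (q : ℕ) (j : σ) (b : σ → K) (hbj : b j = 0) (t : IFPState σ K)
    (hlev : ∀ J ∈ t.idx, J.degree < q)
    (hsing : ∀ J ∈ t.idx, t.gen J ≠ 0 → (((q - J.degree : ℕ) : ℕ∞)) ≤ ordZero (t.gen J))
    (hstall : t.muTilde q ≤ (t.step q j b).muTilde q)
    {J₀ : σ →₀ ℕ} (hJ₀ : J₀ ∈ t.idx) (hμ : t.muP q = levelRatio (ordZero (t.gen J₀)) (q - J₀.degree))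
    {d₀ : ℕ} (hd₀ : ordZero (t.gen J₀) = d₀) :
    (t.step q j b).muPD q j = (((((d₀ - (q - J₀.degree) : ℕ) : ℚ) / (q - J₀.degree : ℕ) : ℚ)) : WithTop ℚ) := by
  have h5 := (stall_rigid q j b hbj t hlev hsing hstall hJ₀ hμ hd₀).2.2.2.2
  have ha₀pos : 0 < q - J₀.degree := by have := hlev J₀ hJ₀; omega
  have hg₀ne : t.gen J₀ ≠ 0 := by
    intro h0; rw [h0, ordZero_zero] at hd₀; exact ENat.top_ne_coe _ hd₀
  have had₀ : q - J₀.degree ≤ d₀ := by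
    have := hsing J₀ hJ₀ hg₀ne; rw [hd₀] at this; exact_mod_cast this
  rw [h5, WithTop.coe_eq_coe, Nat.cast_sub had₀, sub_div,
    div_self (show ((q - J₀.degree : ℕ) : ℚ) ≠ 0 by exact_mod_cast ha₀pos.ne')]

/-- **(D2, kept letter) THE KEPT-LETTER LAW**: a kept letter (`i ≠ j`, `b_i = 0`) whose mass equals its share
`S'_i / a₀` of a monomial `u^{S'}` of the TRANSPORTED generator keeps that mass: it cannot decrease under the move
(`divisorOrder_le_divisorOrder_kept`) and cannot exceed the share (D0). [new] [folklore] -/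
theorem kept_nondeficient (q : ℕ) (j : σ) (b : σ → K) (t : IFPState σ K) {J₀ : σ →₀ ℕ} (hJ₀ : J₀ ∈ t.idx)
    {i : σ} (hij : i ≠ j) (hbi : b i = 0) {S' : σ →₀ ℕ} (hS' : S' ∈ ((t.step q j b).gen J₀).support)
    (hx : t.muPD q i = ((((S' i : ℕ) : ℚ) / (q - J₀.degree : ℕ) : ℚ) : WithTop ℚ)) :
    (t.step q j b).muPD q i = ((((S' i : ℕ) : ℚ) / (q - J₀.degree : ℕ) : ℚ) : WithTop ℚ) := by
  apply le_antisymm (muPD_le_exponent q (t.step q j b) (show J₀ ∈ t.idx from hJ₀) hS' i)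
  rw [← hx]
  refine Finset.le_inf fun J hJ => ?_
  calc t.muPD q i ≤ levelRatio (divisorOrder i (t.gen J)) (q - J.degree) := Finset.inf_le hJ
    _ ≤ levelRatio (divisorOrder i (PointBlowup.translate b (chartTransform (q - J.degree) j (t.gen J))))
        (q - J.degree) := levelRatio_mono (divisorOrder_le_divisorOrder_kept b hij hbi _ _) _

/-! ### §2d (rev 8, generation 22) THE NULL LAW — `μ̃ = 0` forces the FLAT young monomial cone

At `μ̃ = 0`, `d₀/a₀ = μ_P = Σ_young μ_{P,D_i}`, while (D0) `a₀ μ_{P,D_i} ≤ m_i` for EVERY monomial `u^m` of the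
minimiser `g₀`; on a monomial of the cone (`|m| = d₀`) the budget is exhausted: `m_i = a₀ μ_{P,D_i}` on the young
letters and `m_i = 0` on the old ones (`young_exponent_of_muTilde_zero`).  Hence the cone has ONE monomial, the flat
young monomial `u^S`, `S_i = a₀ μ_{P,D_i}` (`flat_cone_of_muTilde_zero`): `μ̃ = 0` IS the flat regime, state by
state — the converse of `muTilde_eq_zero_of_flatMonomialAt`. -/

omit [DecidableEq K] in
/-- **(N1) THE EXPONENT LAW AT `μ̃ = 0`**: every monomial `u^m` of the cone of a minimiser has `μ_{P,D_i} = m_i/a₀` at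
every young letter and no old letter. (Sources: KawanoueMatsuki2016, §4.1 (μ̃ = 0 ⟺ monomial case); new as a law on the
cone.) -/
theorem young_exponent_of_muTilde_zero (q : ℕ) (t : IFPState σ K) {J₀ : σ →₀ ℕ} (hJ₀ : J₀ ∈ t.idx)
    (hlev : J₀.degree < q) (hμ : t.muP q = levelRatio (ordZero (t.gen J₀)) (q - J₀.degree)) {d₀ : ℕ}
    (hd₀ : ordZero (t.gen J₀) = d₀) (h0 : t.muTilde q = 0) {m : σ →₀ ℕ} (hm : m ∈ (t.gen J₀).support)
    (hmd : m.degree = d₀) :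
    (∀ i ∈ t.young, t.muPD q i = ((((m i : ℕ) : ℚ) / (q - J₀.degree : ℕ) : ℚ) : WithTop ℚ)) ∧
      ∀ i, m i ≠ 0 → i ∈ t.young := by
  classical
  have ha₀ : (0 : ℚ) < ((q - J₀.degree : ℕ) : ℚ) := by exact_mod_cast Nat.sub_pos_of_lt hlev
  have hD0 : ∀ i, (t.muPD q i).untopD 0 ≤ ((m i : ℕ) : ℚ) / (q - J₀.degree : ℕ) := fun i =>
    untopD_muPD_le_exponent q t hJ₀ hm i
  have hf0 : ∀ i, (0 : ℚ) ≤ ((m i : ℕ) : ℚ) / (q - J₀.degree : ℕ) := fun i =>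
    div_nonneg (Nat.cast_nonneg _) ha₀.le
  have hz : (d₀ : ℚ) / (q - J₀.degree : ℕ) - ∑ i ∈ t.young, (t.muPD q i).untopD 0 = 0 := by
    have h := muTilde_eq_at q t hμ hd₀
    rw [h0, ← WithTop.coe_zero, WithTop.coe_eq_coe] at h
    exact h.symm
  have hdeg : ∑ i, ((m i : ℕ) : ℚ) / (q - J₀.degree : ℕ) = (d₀ : ℚ) / (q - J₀.degree : ℕ) := by
    rw [← Finset.sum_div]
    congr 1
    rw [← hmd, Finsupp.degree_eq_sum, Nat.cast_sum]
  have h1 : ∑ i ∈ t.young, (t.muPD q i).untopD 0 ≤ ∑ i ∈ t.young, ((m i : ℕ) : ℚ) / (q - J₀.degree : ℕ) :=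
    Finset.sum_le_sum fun i _ => hD0 i
  have h2 : ∑ i ∈ t.young, ((m i : ℕ) : ℚ) / (q - J₀.degree : ℕ) ≤ ∑ i, ((m i : ℕ) : ℚ) / (q - J₀.degree : ℕ) :=
    Finset.sum_le_sum_of_subset_of_nonneg (Finset.subset_univ _) fun i _ _ => hf0 i
  have hyg : ∑ i ∈ t.young, (t.muPD q i).untopD 0 = ∑ i ∈ t.young, ((m i : ℕ) : ℚ) / (q - J₀.degree : ℕ) := by
    linarith
  have hyf : ∑ i ∈ t.young, ((m i : ℕ) : ℚ) / (q - J₀.degree : ℕ) = ∑ i, ((m i : ℕ) : ℚ) / (q - J₀.degree : ℕ) := by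
    linarith
  have hterm := (Finset.sum_eq_sum_iff_of_le fun i _ => hD0 i).mp hyg
  refine ⟨fun i hi => ?_, fun i hi => ?_⟩
  · have hne : t.muPD q i ≠ ⊤ := ne_top_of_le_ne_top WithTop.coe_ne_top (muPD_le_exponent q t hJ₀ hm i)
    obtain ⟨v, hv⟩ := WithTop.ne_top_iff_exists.mp hne
    have h := hterm i hi
    rw [← hv, WithTop.untopD_coe] at h
    rw [← hv, h]
  · by_contra hiy
    have hrest : ∑ i ∈ univ \ t.young, ((m i : ℕ) : ℚ) / (q - J₀.degree : ℕ) = 0 := by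
      have h := Finset.sum_sdiff (Finset.subset_univ t.young) (f := fun i => ((m i : ℕ) : ℚ) / (q - J₀.degree : ℕ))
      linarith
    have h := (Finset.sum_eq_zero_iff_of_nonneg fun i _ => hf0 i).mp hrest i
      (Finset.mem_sdiff.mpr ⟨Finset.mem_univ _, hiy⟩)
    rcases div_eq_zero_iff.mp h with h' | h'
    · exact hi (by exact_mod_cast h')
    · exact absurd h' ha₀.ne'

omit [DecidableEq K] in
/-- **(N2) THE NULL LAW — `μ̃ = 0` FORCES THE FLAT YOUNG MONOMIAL CONE**: at `μ̃ = 0` the cone of EVERY `μ_P`-minimiser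
`J₀` is a single young monomial `ρ·u^S` with `μ_{P,D_i} = S_i / a₀` at every young letter (`u^S =
Mon(ℛ)^{a₀}`). (Sources: KawanoueMatsuki2016, §4.1, §5.3; new as a law on the cone.) -/
theorem flat_cone_of_muTilde_zero (q : ℕ) (t : IFPState σ K) {J₀ : σ →₀ ℕ} (hJ₀ : J₀ ∈ t.idx)
    (hlev : J₀.degree < q) (hμ : t.muP q = levelRatio (ordZero (t.gen J₀)) (q - J₀.degree)) {d₀ : ℕ}
    (hd₀ : ordZero (t.gen J₀) = d₀) (h0 : t.muTilde q = 0) :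
    ∃ (S : σ →₀ ℕ) (ρ : K), ρ ≠ 0 ∧ S.degree = d₀ ∧ homogeneousComponent d₀ (t.gen J₀) = monomial S ρ ∧
      (∀ i, S i ≠ 0 → i ∈ t.young) ∧
      ∀ i ∈ t.young, t.muPD q i = ((((S i : ℕ) : ℚ) / (q - J₀.degree : ℕ) : ℚ) : WithTop ℚ) := by
  classical
  have hΦ0 : homogeneousComponent d₀ (t.gen J₀) ≠ 0 := homogeneousComponent_ne_zero_of_ordZero_eq hd₀
  obtain ⟨S, hS⟩ := MvPolynomial.ne_zero_iff.mp hΦ0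
  have hSc : S ∈ (homogeneousComponent d₀ (t.gen J₀)).support := MvPolynomial.mem_support_iff.mpr hS
  have hSdeg : S.degree = d₀ := degree_eq_of_mem_support_homogeneousComponent hSc
  have hSg : S ∈ (t.gen J₀).support := mem_support_of_mem_support_homogeneousComponent hSc
  have hSlaw := young_exponent_of_muTilde_zero q t hJ₀ hlev hμ hd₀ h0 hSg hSdeg
  have ha₀ : (0 : ℚ) < ((q - J₀.degree : ℕ) : ℚ) := by exact_mod_cast Nat.sub_pos_of_lt hlev
  have huniq : ∀ m ∈ (homogeneousComponent d₀ (t.gen J₀)).support, m = S := by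
    intro m hmc
    have hmdeg : m.degree = d₀ := degree_eq_of_mem_support_homogeneousComponent hmc
    have hmg : m ∈ (t.gen J₀).support := mem_support_of_mem_support_homogeneousComponent hmc
    have hmlaw := young_exponent_of_muTilde_zero q t hJ₀ hlev hμ hd₀ h0 hmg hmdeg
    ext i
    by_cases hi : i ∈ t.young
    · have h := (hmlaw.1 i hi).symm.trans (hSlaw.1 i hi)
      rw [WithTop.coe_eq_coe] at h
      have h' := (div_left_inj' ha₀.ne').mp h
      exact_mod_cast h'
    · have h1 : m i = 0 := by
        by_contra h; exact hi (hmlaw.2 i h)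
      have h2 : S i = 0 := by
        by_contra h; exact hi (hSlaw.2 i h)
      rw [h1, h2]
  have hsupp : (homogeneousComponent d₀ (t.gen J₀)).support = {S} :=
    Finset.eq_singleton_iff_unique_mem.mpr ⟨hSc, huniq⟩
  have hΦeq : homogeneousComponent d₀ (t.gen J₀) = monomial S (coeff S (homogeneousComponent d₀ (t.gen J₀))) := by
    conv_lhs => rw [(homogeneousComponent d₀ (t.gen J₀)).as_sum, hsupp, Finset.sum_singleton]
  exact ⟨S, _, hS, hSdeg, hΦeq, hSlaw.2, hSlaw.1⟩

end Vertex

end Summit.ResolutionOfSingularities.ResolutionOfSingularities.Theorems.StallVertex
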